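import Summits.QuantumFields.YangMills.Theorems.BalabanUVNodesN15FullPropagatorV1XTwoSidedNode
import Summits.QuantumFields.YangMills.Theorems.BalabanUVNodesN15CurvedTransporterOrthogonality
import HarnessLib

/-!
# Route «BalabanUVNodes» (cluster K4 «SpineRates»), Track-A DAG node N15 = NE2, BACKGROUND LAYER — DICTIONARY: n15-w3's CURVED coefficients AT THE FLAT BASE POINT of an EXACT exponential
# transporter field `S = expTrField e η (ad∘A)` ARE dag-n15-c's exact coefficients `(v1coefCX, v1coefAX)` of the gauge triple `v1fieldsOfGauge τ η A` (skew coordinates, `η ≠ 0`), so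
# dag-n15-c FILE 29b's FIFTEEN `TwoSidedLetters` — rows, GRADIENT rows `fgradMat`, fits, translated and derivative fits — hold for the curved coefficient pairs BY NAME (the
# «`rowSum_fgradMat_curvCoefA`-type letters» asked by dag-n15-w1 g5 for entry 2 of the curved King family)

Cell `pub-ymgap`, seat `pub-ymgap-dag-n15-w2` (WIDTH SEAT 2∕3 on node N15, director-ym №197 ∕ HUMAN RULING D-0149), g6, sixth piece (bus CLAIM-6 I.40895; ASKED BY NAME by dag-n15-w1 g5
I.≈40810 «(ii) … n15-w2 g5∕g6: do `rowSum_fgradMat_curvCoefA`-type letters exist? say so»).  `bears_on: R4∕N15 · K3⁸ SpineGivenEndpointR13SepCoPHV (stmt-QuantumFields-27366)`.  Filed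
`--kind proof --supports stmt-QuantumFields-27366 --as helper` — COUNT-NEUTRAL.  Theorems only; 0 `def`, 0 `sorry`.  Imports BY NAME dag-n15-c g10 FILE 29b `…BackgroundV1ExactLetters`
and FILE 30 `…FullPropagatorV1XTwoSidedNode` (★★ `twoSidedLettersX_of_gauge`, ★★★ `twoSidedLettersX_of_meanGauge`, `gavgM`; through them FILE 28 `tCoefA_gaugeTransport`, `tCoefC_gaugeTransport`, `gaugeTransport`, `v1coefAX`, `v1coefCX`, V1b `v1fieldsOfGauge`, FILE 24
`TwoSidedLetters`) and this seat's g2 `…CurvedTransporterOrthogonality` (★ `gaugeTransport_eq_gaugePair_of_skew`; through it n15-w3 files 1∕5 `curvCoefA_one`, `curvCoefC_one`, `expTrField`);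
nothing in the tree is modified, no landed name re-declared.

WHY.  dag-n15-w1 g5's operator layer of the curved King family (parts XXXVI–XLI) reads the background through n15-w3's curved species at the flat base point,
`(curvCoefC η τ 1 S, curvCoefA η τ 1 S)` with `S = expTrField e η (ad∘A′) = coordMat e (Ad(e^{ηA′}))` EXACTLY, and its by-parts entry 2 (dag-n15-c FILE 23 `hasMaj_entry2_byParts_matrix₂_of_letters`)
wants the fifteen `TwoSidedLetters` of those coefficient pairs — in particular the GRADIENT rows `fgradMat N τ (curvCoefA … (inl μ))`.  They EXIST: dag-n15-c FILE 29b proved them for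
`(v1coefCX e η (v1fieldsOfGauge 𝔄 J τ η A), v1coefAX e η (…))`, and three landed identities say these ARE the curved pairs: n15-w3 `curvCoefA_one`∕`curvCoefC_one`
(`curvCoef? η τ 1 S = tCoef? η (gaugePair τ S)`), g2 `gaugeTransport_eq_gaugePair_of_skew` (`gaugeTransport e τ η A = gaugePair τ (expTrField e η (ad∘A))` when the coordinates of `ad_{A}` are
skew — automatic for 𝔲(N)-valued `A` in trace-form coordinates and for `ℍ`, p595427∕p593011) and FILE 28 `tCoefA_gaugeTransport`∕`tCoefC_gaugeTransport` (`= v1coefAX∕CX`, `η ≠ 0`).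
THIS FILE is the citable dictionary: ★ `curvCoefA_one_expTrField_eq_v1coefAX`, ★ `curvCoefC_one_expTrField_eq_v1coefCX`, the pair form `curvCoef_one_expTrField_pair_eq`, and ★★
`twoSidedLetters_curvCoef_one_of_gauge` = FILE 29b's theorem RE-KEYED to the curved pairs on two grids (gauge-field letters in, fifteen coefficient letters out; conjuncts 7–10 are the
`fgradMat` rows); ★★ `twoSidedLetters_curvCoef_one_of_meanGauge` = FILE 30's block-mean edition re-keyed (ONE fine potential with the window's C² letters, coarse = `gavgM`).

HONEST FRAMING ∕ LIMITS.  Three rewrites and one application of a landed theorem; skew coordinates and `η, η′ ≠ 0` are hypotheses; the gauge-field letters (sup, one-step, fits) are the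
consumer's (3.35)-window; nothing of [B5]∕[B6]∕[B9] asserted beyond cited shapes; NE2⁺ NOT PRINTED ∕ NOT proved; N15 NOT discharged; K3⁸ OPEN, skeleton v6 untouched (0∕2); counts of record
UNMOVED (typed 28∕28 · discharged 5∕27 · A 5∕28); one finite 𝕋⁴ at fixed ε — NOT ℝ⁴ ∕ OS ∕ mass gap ∕ Clay; R4 closes the conditional finite-𝕋⁴ rung `BalabanLadder.UV` only.  Restate-immune.
-/

set_option autoImplicit false

noncomputable section
open scoped BigOperators Matrix

namespace Summit.QuantumFields.YangMills.BalabanUVNodes.N15.CurvedSpecies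

open Literature.MathematicalPhysics.QuantumFieldTheory.Balaban1983to89.Beta.AveragingCorrectionJets (adCLM)
open Summit.QuantumFields.YangMills.BalabanUVNodes.N15.MatrixSpecies (coordMat basisConst)
open Summit.QuantumFields.YangMills.BalabanUVNodes.N15.BackgroundLayer (tCoefA tCoefC gaugeTransport v1coefAX v1coefCX v1fieldsOfGauge TwoSidedLetters gavgM
  tCoefA_gaugeTransport tCoefC_gaugeTransport twoSidedLettersX_of_gauge twoSidedLettersX_of_meanGauge)

variable {X X' J ι : Type} [Fintype ι] [DecidableEq ι] {𝔄 : Type} [NormedRing 𝔄] [NormedAlgebra ℝ 𝔄] [CompleteSpace 𝔄] (e : 𝔄 ≃L[ℝ] (ι → ℝ))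

/-! ## §1 The dictionary -/

section Dictionary

variable [Fintype J] (η : ℝ) (τ : J → X ≃ X) (A : J → X → 𝔄)

/-- ★ **FIRST-ORDER COEFFICIENTS**: at the flat base point the curved coefficients of the exact exponential transporter field `S = expTrField e η (ad∘A)` are dag-n15-c's exact coefficients:
`curvCoefA η τ 1 S = v1coefAX e η (v1fieldsOfGauge 𝔄 J τ η A)` (`η ≠ 0`, skew coordinates of `ad_{A}`). [cite: Balaban1985BackgroundPropagators, (3.51)–(3.52) p.400] -/
theorem curvCoefA_one_expTrField_eq_v1coefAX (hη : η ≠ 0) (hA : ∀ μ x, (coordMat e (adCLM ℝ (A μ x)))ᵀ = -coordMat e (adCLM ℝ (A μ x))) :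
    curvCoefA η τ (fun (_ : J) (_ : X) => (1 : Matrix ι ι ℝ)) (expTrField e η (fun μ x => adCLM ℝ (A μ x))) = v1coefAX e η (v1fieldsOfGauge 𝔄 J τ η A) := by
  rw [curvCoefA_one, ← gaugeTransport_eq_gaugePair_of_skew e η τ A hA, tCoefA_gaugeTransport e hη]

/-- ★ **ZEROTH-ORDER COEFFICIENT**: `curvCoefC η τ 1 S = v1coefCX e η (v1fieldsOfGauge 𝔄 J τ η A)` likewise. [cite: Balaban1985BackgroundPropagators, (3.51)–(3.52) p.400] -/
theorem curvCoefC_one_expTrField_eq_v1coefCX (hη : η ≠ 0) (hA : ∀ μ x, (coordMat e (adCLM ℝ (A μ x)))ᵀ = -coordMat e (adCLM ℝ (A μ x))) :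
    curvCoefC η τ (fun (_ : J) (_ : X) => (1 : Matrix ι ι ℝ)) (expTrField e η (fun μ x => adCLM ℝ (A μ x))) = v1coefCX e η (v1fieldsOfGauge 𝔄 J τ η A) := by
  rw [curvCoefC_one, ← gaugeTransport_eq_gaugePair_of_skew e η τ A hA, tCoefC_gaugeTransport e hη]

/-- The PAIR form (the configurations of dag-n15-c FILE 24's `TwoSidedLetters`). [cite: Balaban1985BackgroundPropagators, (3.51)–(3.52) p.400] -/
theorem curvCoef_one_expTrField_pair_eq (hη : η ≠ 0) (hA : ∀ μ x, (coordMat e (adCLM ℝ (A μ x)))ᵀ = -coordMat e (adCLM ℝ (A μ x))) :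
    (curvCoefC η τ (fun (_ : J) (_ : X) => (1 : Matrix ι ι ℝ)) (expTrField e η (fun μ x => adCLM ℝ (A μ x))),
      curvCoefA η τ (fun (_ : J) (_ : X) => (1 : Matrix ι ι ℝ)) (expTrField e η (fun μ x => adCLM ℝ (A μ x)))) =
      (v1coefCX e η (v1fieldsOfGauge 𝔄 J τ η A), v1coefAX e η (v1fieldsOfGauge 𝔄 J τ η A)) := by
  rw [curvCoefA_one_expTrField_eq_v1coefAX e η τ A hη hA, curvCoefC_one_expTrField_eq_v1coefCX e η τ A hη hA]

end Dictionary

/-! ## §2 The fifteen letters for the curved coefficient pairs on two grids -/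

section Letters

variable [Fintype J]

/-- ★★ **THE FIFTEEN `TwoSidedLetters` FOR THE CURVED COEFFICIENT PAIRS AT THE FLAT BASE POINT, TWO GRIDS** — dag-n15-c FILE 29b `twoSidedLettersX_of_gauge` re-keyed by §1: fine potential
`A′` (spacing `η′`, shifts `s′`), coarse potential `A` (spacing `η`, shifts `s`), `0 < η′ ≤ η ≤ min(1, θ)`, both with skew coordinates of `ad`, and the GAUGE-FIELD letters at `r`
(`2(1+|J|)r ≤ 1`): sups `≤ r`, own-direction one-step letters `≤ rη′` ∕ `≤ rη`, fit ∕ translated fit ∕ derivative fit across `π` `≤ rθ` ⟹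
`TwoSidedLetters J ι π s s′ η⁻¹ η′⁻¹ (14e(1+|J|)κ_e·(1+|J|)r) θ (curvCoefC η′ s′ 1 S′, curvCoefA η′ s′ 1 S′) (curvCoefC η s 1 S, curvCoefA η s 1 S)`,
`S^{(′)} = expTrField e η^{(′)} (ad∘A^{(′)})` — rows, `fgradMat` GRADIENT rows (conjuncts 7–10), row fits, translated fits, derivative fits, coarse oscillation.
[cite: Balaban1985BackgroundPropagators, (3.35)–(3.36) p.396, (3.52) p.400 (shapes)] -/
theorem twoSidedLetters_curvCoef_one_of_gauge {π : X' → X} {s : J → X ≃ X} {s' : J → X' ≃ X'} {η η' r θ : ℝ} (hη' : 0 < η') (hη'η : η' ≤ η) (hη1 : η ≤ 1)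
    (hηθ : η ≤ θ) (hr : 0 ≤ r) (hr2 : 2 * ((1 + Fintype.card J) * r) ≤ 1) {A' : J → X' → 𝔄} {A : J → X → 𝔄}
    (hA' : ∀ μ x', (coordMat e (adCLM ℝ (A' μ x')))ᵀ = -coordMat e (adCLM ℝ (A' μ x'))) (hA : ∀ μ x, (coordMat e (adCLM ℝ (A μ x)))ᵀ = -coordMat e (adCLM ℝ (A μ x)))
    (hs' : ∀ μ x', ‖A' μ x'‖ ≤ r) (hs : ∀ μ x, ‖A μ x‖ ≤ r) (hd' : ∀ μ x', ‖A' μ x' - A' μ ((s' μ).symm x')‖ ≤ r * η') (hd : ∀ μ x, ‖A μ x - A μ ((s μ).symm x)‖ ≤ r * η)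
    (hf : ∀ μ x', ‖A' μ x' - A μ (π x')‖ ≤ r * θ) (hfT : ∀ μ x', ‖A' μ ((s' μ).symm x') - A μ ((s μ).symm (π x'))‖ ≤ r * θ)
    (hfD : ∀ μ x', ‖η'⁻¹ • (A' μ x' - A' μ ((s' μ).symm x')) - η⁻¹ • (A μ (π x') - A μ ((s μ).symm (π x')))‖ ≤ r * θ) :
    TwoSidedLetters J ι π s s' η⁻¹ η'⁻¹ (14 * Real.exp 1 * (1 + Fintype.card J) * basisConst e * ((1 + Fintype.card J) * r)) θ
      (curvCoefC η' s' (fun (_ : J) (_ : X') => (1 : Matrix ι ι ℝ)) (expTrField e η' (fun μ x' => adCLM ℝ (A' μ x'))),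
        curvCoefA η' s' (fun (_ : J) (_ : X') => (1 : Matrix ι ι ℝ)) (expTrField e η' (fun μ x' => adCLM ℝ (A' μ x'))))
      (curvCoefC η s (fun (_ : J) (_ : X) => (1 : Matrix ι ι ℝ)) (expTrField e η (fun μ x => adCLM ℝ (A μ x))),
        curvCoefA η s (fun (_ : J) (_ : X) => (1 : Matrix ι ι ℝ)) (expTrField e η (fun μ x => adCLM ℝ (A μ x)))) := by
  have hη : 0 < η := lt_of_lt_of_le hη' hη'η
  rw [curvCoef_one_expTrField_pair_eq e η' s' A' hη'.ne' hA', curvCoef_one_expTrField_pair_eq e η s A hη.ne' hA]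
  exact twoSidedLettersX_of_gauge e hη' hη'η hη1 hηθ hr hr2 hs' hs hd' hd hf hfT hfD

/-- ★★ **THE SAME WITH THE COARSE POTENTIAL = THE BLOCK MEAN OF THE FINE ONE** — dag-n15-c FILE 30 `twoSidedLettersX_of_meanGauge` re-keyed by §1: ONE fine potential `A′` with the
C² letters of the (3.35)–(3.36) window (sup `≤ r`, ALL one-step differences `≤ rη′`, mixed second differences `≤ rη′²` — dag-n15-w1's `hgradA`∕`hsecA` clauses), coarse potential
`Ā′ = gavgM 𝔄 J π A′`, the block geometry (`hcomm`, `hconn`, `hblk`, `η = Nη′`), skew coordinates of `ad∘A′` and of `ad∘Ā′` ⟹ the fifteen `TwoSidedLetters` for the curved pairs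
`(curvCoefC η′ s′ 1 S′, curvCoefA η′ s′ 1 S′)`, `(curvCoefC η s 1 S̄, curvCoefA η s 1 S̄)`, `S′ = expTrField e η′ (ad∘A′)`, `S̄ = expTrField e η (ad∘Ā′)`, at scale
`14e(1+|J|)κ_e·(1+|J|)(3+C₀)r`, rate `θ`. [cite: Balaban1985BackgroundPropagators, (3.35)–(3.36) p.396, (3.52) p.400 (shapes); King1986, p.664 (block-mean convention)] -/
theorem twoSidedLetters_curvCoef_one_of_meanGauge [Fintype X] [Fintype X'] [DecidableEq X] {π : X' → X} {s : J → X ≃ X} {s' : J → X' ≃ X'} {N : ℕ}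
    {η η' r θ Cπ C₀ : ℝ} (hcomm : ∀ μ κ x, (s' μ).symm (s' κ x) = s' κ ((s' μ).symm x))
    (hconn : ∀ (f : X' → 𝔄) (β : ℝ), (∀ κ x, ‖f (s' κ x) - f x‖ ≤ β) → ∀ x₁ x₂, π x₁ = π x₂ → ‖f x₁ - f x₂‖ ≤ Cπ * β)
    (hblk : ∀ μ x', π ((s' μ ^ N) x') = s μ (π x')) (hη' : 0 < η') (hN : η = N * η') (hη : 0 < η) (hη1 : η ≤ 1) (hηθ : η ≤ θ) (hC₀ : 0 ≤ C₀)
    (hCθ : Cπ * η' ≤ C₀ * θ) (hr : 0 ≤ r) (hr2 : 2 * ((1 + Fintype.card J) * ((3 + C₀) * r)) ≤ 1) {A' : J → X' → 𝔄}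
    (hA' : ∀ μ x', (coordMat e (adCLM ℝ (A' μ x')))ᵀ = -coordMat e (adCLM ℝ (A' μ x')))
    (hAm : ∀ μ x, (coordMat e (adCLM ℝ (gavgM 𝔄 J π A' μ x)))ᵀ = -coordMat e (adCLM ℝ (gavgM 𝔄 J π A' μ x)))
    (h1 : ∀ μ x', ‖A' μ x'‖ ≤ r) (h2 : ∀ μ κ x', ‖A' μ (s' κ x') - A' μ x'‖ ≤ r * η')
    (h3 : ∀ μ κ x', ‖(A' μ (s' κ x') - A' μ x') - (A' μ (s' κ ((s' μ).symm x')) - A' μ ((s' μ).symm x'))‖ ≤ r * η' * η') :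
    TwoSidedLetters J ι π s s' η⁻¹ η'⁻¹ (14 * Real.exp 1 * (1 + Fintype.card J) * basisConst e * ((1 + Fintype.card J) * ((3 + C₀) * r))) θ
      (curvCoefC η' s' (fun (_ : J) (_ : X') => (1 : Matrix ι ι ℝ)) (expTrField e η' (fun μ x' => adCLM ℝ (A' μ x'))),
        curvCoefA η' s' (fun (_ : J) (_ : X') => (1 : Matrix ι ι ℝ)) (expTrField e η' (fun μ x' => adCLM ℝ (A' μ x'))))
      (curvCoefC η s (fun (_ : J) (_ : X) => (1 : Matrix ι ι ℝ)) (expTrField e η (fun μ x => adCLM ℝ (gavgM 𝔄 J π A' μ x))),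
        curvCoefA η s (fun (_ : J) (_ : X) => (1 : Matrix ι ι ℝ)) (expTrField e η (fun μ x => adCLM ℝ (gavgM 𝔄 J π A' μ x)))) := by
  rw [curvCoef_one_expTrField_pair_eq e η' s' A' hη'.ne' hA', curvCoef_one_expTrField_pair_eq e η s (gavgM 𝔄 J π A') hη.ne' hAm]
  exact twoSidedLettersX_of_meanGauge e hcomm hconn hblk hη' hN hη hη1 hηθ hC₀ hCθ hr hr2 h1 h2 h3

end Letters

end Summit.QuantumFields.YangMills.BalabanUVNodes.N15.CurvedSpecies

end
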